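import Summits.NavierStokesRegularity.NavierStokesRegularity.Theorems.HubbleDynamoBackusRungCalculus

/-!
# Backus bound in Hubble flow — the energy identities (route HubbleDynamo, item `BackusRung`)

Whole-space energy identities on `ℝ³` for smooth fields with `b, ∇b ∈ L²` (and `|y| b ∈ L²` for
the dilution term), used in the proof of `BackusRung` (item stmt-NavierStokesRegularity-1939):

* stretching: `∫ ∑ⱼ bⱼ ⟪b, ∂ⱼ U⟫ = −∫ ∑ⱼ bⱼ ⟪∂ⱼ b, U⟫` (`div b = 0`);
* transport: `∫ ∑ⱼ Uⱼ ⟪b, ∂ⱼ b⟫ = 0` (`div U = 0`);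
* Hubble dilution: `∫ ∑ⱼ yⱼ ⟪b, ∂ⱼ b⟫ = −(3/2) ‖b‖²` (`div y = 3`);
* dissipation: `∫ ⟪b, Δb⟫ = −∫ ∑ⱼ ‖∂ⱼ b‖²`, needing only `⟪b, Δb⟫ ∈ L¹` (not `D²b ∈ L²`).

Each is Mathlib's whole-space integration by parts, one coordinate direction at a time
(`backus_ibp_smul_inner`), except the last, which uses the cutoff divergence lemma
`backus_integral_sum_partial_eq_zero`.
-/

noncomputable section

open MeasureTheory Filter Topology WithLp
open scoped RealInnerProductSpace

-- tree namespace `Summit.<S>.<S>.Theorems` (summit = sub-problem), as in every Theorems file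
set_option linter.dupNamespace false

namespace Summit.NavierStokesRegularity.NavierStokesRegularity.Theorems

open Literature.Analysis.FluidPDE

/-! ### Integrability from a pointwise bound -/

/-- A continuous real function dominated by an integrable one is integrable. -/
theorem backus_integrable_of_bound {F g : EuclideanSpace ℝ (Fin 3) → ℝ} (hF : Continuous F) (hg :
    Integrable g)
    (h : ∀ y, ‖F y‖ ≤ g y) : Integrable F :=
  hg.mono' hF.aestronglyMeasurable (ae_of_all _ h)

/-! ### The three first-order energy identities -/

/-- Stretching term: `∫ ∑ⱼ bⱼ ⟪b, ∂ⱼU⟫ = −∫ ∑ⱼ bⱼ ⟪∂ⱼ b, U⟫` for `div b = 0` (move the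
derivative from `U` onto `bⱼ b`; the term with `∂ⱼ bⱼ` sums to zero). -/
theorem backus_integral_stretch {U b : EuclideanSpace ℝ (Fin 3) → EuclideanSpace ℝ (Fin 3)} {C₀ : ℝ}
    (hU1 : ContDiff ℝ 1 U) (hb1 : ContDiff ℝ 1 b) (hdivb : ∀ y, ∑ j, fderiv ℝ b y
        (EuclideanSpace.single j 1) j = 0)
    (hUb : ∀ y, ‖U y‖ ≤ C₀)
    (h1 : ∀ j, Integrable fun y => b y j * ⟪b y, fderiv ℝ U y (EuclideanSpace.single j 1)⟫)
    (h3 : ∀ j, Integrable fun y => b y j * ⟪fderiv ℝ b y (EuclideanSpace.single j 1), U y⟫)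
    (hP : Integrable fun y => ‖b y‖ ^ 2)
    (hD3 : Integrable fun y => ‖b y‖ * ‖fderiv ℝ b y‖) :
    ∫ y, ∑ j, b y j * ⟪b y, fderiv ℝ U y (EuclideanSpace.single j 1)⟫ =
      -∫ y, ∑ j, b y j * ⟪fderiv ℝ b y (EuclideanSpace.single j 1), U y⟫ := by
  have hbd : Differentiable ℝ b := hb1.differentiable one_ne_zero
  have hUd : Differentiable ℝ U := hU1.differentiable one_ne_zero
  have hbc : Continuous b := hb1.continuous
  have hUc : Continuous U := hU1.continuous
  have hDbc : ∀ j, Continuous fun y => fderiv ℝ b y (EuclideanSpace.single j 1) := fun j =>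
    (hb1.continuous_fderiv one_ne_zero).clm_apply continuous_const
  have hbjc : ∀ j, Continuous fun y => b y j := fun j =>
    (EuclideanSpace.proj (𝕜 := ℝ) j).continuous.comp hbc
  have hDbjjc : ∀ j, Continuous fun y => fderiv ℝ b y (EuclideanSpace.single j 1) j := fun j =>
    (EuclideanSpace.proj (𝕜 := ℝ) j).continuous.comp (hDbc j)
  have h2' : ∀ j, Integrable fun y => fderiv ℝ b y (EuclideanSpace.single j 1) j * ⟪b y, U y⟫ := by
    intro j
    refine backus_integrable_of_bound ((hDbjjc j).mul (hbc.inner hUc)) (hD3.const_mul C₀)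
      fun y => ?_
    rw [norm_mul]
    calc ‖fderiv ℝ b y (EuclideanSpace.single j 1) j‖ * ‖⟪b y, U y⟫‖
        ≤ ‖fderiv ℝ b y‖ * (‖b y‖ * C₀) :=
          mul_le_mul ((PiLp.norm_apply_le _ _).trans (backus_norm_apply_single_le _ _))
            ((norm_inner_le_norm _ _).trans
              (mul_le_mul_of_nonneg_left (hUb y) (norm_nonneg _)))
            (norm_nonneg _) (norm_nonneg _)
      _ = C₀ * (‖b y‖ * ‖fderiv ℝ b y‖) := by ring
  have h2 : ∀ j, Integrable fun y => fderiv ℝ (fun z => b z j) y (EuclideanSpace.single j 1) * ⟪b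
      y, U y⟫ := by
    intro j
    simpa only [backus_fderiv_apply_coord hbd] using h2' j
  have h4 : ∀ j, Integrable fun y => b y j * ⟪b y, U y⟫ := by
    intro j
    refine backus_integrable_of_bound ((hbjc j).mul (hbc.inner hUc)) (hP.const_mul C₀)
      fun y => ?_
    rw [norm_mul]
    calc ‖b y j‖ * ‖⟪b y, U y⟫‖ ≤ ‖b y‖ * (‖b y‖ * C₀) :=
          mul_le_mul (PiLp.norm_apply_le _ _)
            ((norm_inner_le_norm _ _).trans
              (mul_le_mul_of_nonneg_left (hUb y) (norm_nonneg _)))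
            (norm_nonneg _) (norm_nonneg _)
      _ = C₀ * ‖b y‖ ^ 2 := by ring
  -- integrate by parts in each direction and sum
  have hibp : ∀ j, ∫ y, b y j * ⟪b y, fderiv ℝ U y (EuclideanSpace.single j 1)⟫ =
      -(∫ y, fderiv ℝ b y (EuclideanSpace.single j 1) j * ⟪b y, U y⟫) - ∫ y, b y j * ⟪fderiv ℝ b y
          (EuclideanSpace.single j 1), U y⟫ := by
    intro j
    have h := backus_ibp_smul_inner (EuclideanSpace.single j 1) (backus_differentiable_apply_coord
        hbd j) hbd hUd
      (h1 j) (h2 j) (h3 j) (h4 j)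
    simpa only [backus_fderiv_apply_coord hbd] using h
  have h0 : (fun y => ∑ j, fderiv ℝ b y (EuclideanSpace.single j 1) j * ⟪b y, U y⟫) = fun _ => 0
      := by
    funext y
    rw [← Finset.sum_mul, hdivb y, zero_mul]
  calc ∫ y, ∑ j, b y j * ⟪b y, fderiv ℝ U y (EuclideanSpace.single j 1)⟫
      = ∑ j, ∫ y, b y j * ⟪b y, fderiv ℝ U y (EuclideanSpace.single j 1)⟫ := integral_finsetSum _
          fun j _ => h1 j
    _ = -(∑ j, ∫ y, fderiv ℝ b y (EuclideanSpace.single j 1) j * ⟪b y, U y⟫)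
          - ∑ j, ∫ y, b y j * ⟪fderiv ℝ b y (EuclideanSpace.single j 1), U y⟫ := by
        rw [Finset.sum_congr rfl fun j _ => hibp j, Finset.sum_sub_distrib,
          Finset.sum_neg_distrib]
    _ = -(∫ y, ∑ j, fderiv ℝ b y (EuclideanSpace.single j 1) j * ⟪b y, U y⟫)
          - ∫ y, ∑ j, b y j * ⟪fderiv ℝ b y (EuclideanSpace.single j 1), U y⟫ := by
        rw [integral_finsetSum _ fun j _ => h2' j, integral_finsetSum _ fun j _ => h3 j]
    _ = -∫ y, ∑ j, b y j * ⟪fderiv ℝ b y (EuclideanSpace.single j 1), U y⟫ := by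
        rw [h0, integral_zero, neg_zero, zero_sub]

/-- Transport term: `∫ ∑ⱼ Uⱼ ⟪b, ∂ⱼ b⟫ = 0` for `div U = 0` (it is `½ ∫ U·∇|b|²`). -/
theorem backus_integral_transport {U b : EuclideanSpace ℝ (Fin 3) → EuclideanSpace ℝ (Fin 3)} {C₀
    C₁ : ℝ}
    (hU1 : ContDiff ℝ 1 U) (hb1 : ContDiff ℝ 1 b) (hdivU : ∀ y, ∑ j, fderiv ℝ U y
        (EuclideanSpace.single j 1) j = 0)
    (hUb : ∀ y, ‖U y‖ ≤ C₀) (hC₁ : ∀ y, ‖fderiv ℝ U y‖ ≤ C₁)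
    (h1 : ∀ j, Integrable fun y => U y j * ⟪b y, fderiv ℝ b y (EuclideanSpace.single j 1)⟫)
    (hP : Integrable fun y => ‖b y‖ ^ 2) :
    ∫ y, ∑ j, U y j * ⟪b y, fderiv ℝ b y (EuclideanSpace.single j 1)⟫ = 0 := by
  have hbd : Differentiable ℝ b := hb1.differentiable one_ne_zero
  have hUd : Differentiable ℝ U := hU1.differentiable one_ne_zero
  have hbc : Continuous b := hb1.continuous
  have hUc : Continuous U := hU1.continuous
  have hDUc : ∀ j, Continuous fun y => fderiv ℝ U y (EuclideanSpace.single j 1) := fun j =>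
    (hU1.continuous_fderiv one_ne_zero).clm_apply continuous_const
  have hUjc : ∀ j, Continuous fun y => U y j := fun j =>
    (EuclideanSpace.proj (𝕜 := ℝ) j).continuous.comp hUc
  have hDUjjc : ∀ j, Continuous fun y => fderiv ℝ U y (EuclideanSpace.single j 1) j := fun j =>
    (EuclideanSpace.proj (𝕜 := ℝ) j).continuous.comp (hDUc j)
  have h2' : ∀ j, Integrable fun y => fderiv ℝ U y (EuclideanSpace.single j 1) j * ⟪b y, b y⟫ := by
    intro j
    refine backus_integrable_of_bound ((hDUjjc j).mul (hbc.inner hbc)) (hP.const_mul C₁)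
      fun y => ?_
    rw [norm_mul, real_inner_self_eq_norm_sq, Real.norm_of_nonneg (sq_nonneg ‖b y‖)]
    refine mul_le_mul_of_nonneg_right ?_ (sq_nonneg _)
    exact ((PiLp.norm_apply_le _ _).trans (backus_norm_apply_single_le _ _)).trans (hC₁ y)
  have h2 : ∀ j, Integrable fun y => fderiv ℝ (fun z => U z j) y (EuclideanSpace.single j 1) * ⟪b
      y, b y⟫ := by
    intro j
    simpa only [backus_fderiv_apply_coord hUd] using h2' j
  have h3 : ∀ j, Integrable fun y => U y j * ⟪fderiv ℝ b y (EuclideanSpace.single j 1), b y⟫ :=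
      fun j =>
    (h1 j).congr (ae_of_all _ fun y => by dsimp only; rw [real_inner_comm])
  have h4 : ∀ j, Integrable fun y => U y j * ⟪b y, b y⟫ := by
    intro j
    refine backus_integrable_of_bound ((hUjc j).mul (hbc.inner hbc)) (hP.const_mul C₀)
      fun y => ?_
    rw [norm_mul, real_inner_self_eq_norm_sq, Real.norm_of_nonneg (sq_nonneg ‖b y‖)]
    refine mul_le_mul_of_nonneg_right ?_ (sq_nonneg _)
    exact (PiLp.norm_apply_le _ _).trans (hUb y)
  have hibp : ∀ j, ∫ y, U y j * ⟪b y, fderiv ℝ b y (EuclideanSpace.single j 1)⟫ =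
      -(∫ y, fderiv ℝ U y (EuclideanSpace.single j 1) j * ⟪b y, b y⟫) - ∫ y, U y j * ⟪fderiv ℝ b y
          (EuclideanSpace.single j 1), b y⟫ := by
    intro j
    have h := backus_ibp_smul_inner (EuclideanSpace.single j 1) (backus_differentiable_apply_coord
        hUd j) hbd hbd
      (h1 j) (h2 j) (h3 j) (h4 j)
    simpa only [backus_fderiv_apply_coord hUd] using h
  have hcomm : ∀ j, ∫ y, U y j * ⟪fderiv ℝ b y (EuclideanSpace.single j 1), b y⟫ =
      ∫ y, U y j * ⟪b y, fderiv ℝ b y (EuclideanSpace.single j 1)⟫ := by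
    intro j
    refine integral_congr_ae (ae_of_all _ fun y => ?_)
    dsimp only
    rw [real_inner_comm]
  have hX : ∀ j, 2 * ∫ y, U y j * ⟪b y, fderiv ℝ b y (EuclideanSpace.single j 1)⟫ =
      -∫ y, fderiv ℝ U y (EuclideanSpace.single j 1) j * ⟪b y, b y⟫ := by
    intro j
    have h := hibp j
    rw [hcomm j] at h
    linarith
  have h0 : (fun y => ∑ j, fderiv ℝ U y (EuclideanSpace.single j 1) j * ⟪b y, b y⟫) = fun _ => 0
      := by
    funext y
    rw [← Finset.sum_mul, hdivU y, zero_mul]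
  have hsum : 2 * ∫ y, ∑ j, U y j * ⟪b y, fderiv ℝ b y (EuclideanSpace.single j 1)⟫ = 0 := by
    rw [integral_finsetSum _ fun j _ => h1 j, Finset.mul_sum,
      Finset.sum_congr rfl fun j _ => hX j, Finset.sum_neg_distrib,
      ← integral_finsetSum _ fun j _ => h2' j, h0, integral_zero, neg_zero]
  linarith

/-- Hubble (dilution) term: `∫ ∑ⱼ yⱼ ⟪b, ∂ⱼ b⟫ = −(3/2) ∫ ‖b‖²` (it is `½ ∫ y·∇|b|²` and
`div y = 3`). -/
theorem backus_integral_hubble {b : EuclideanSpace ℝ (Fin 3) → EuclideanSpace ℝ (Fin 3)} (hb1 :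
    ContDiff ℝ 1 b)
    (h1 : ∀ j, Integrable fun y => y j * ⟪b y, fderiv ℝ b y (EuclideanSpace.single j 1)⟫)
    (hP : Integrable fun y => ‖b y‖ ^ 2)
    (hD5 : Integrable fun y => ‖y‖ * ‖b y‖ * ‖b y‖) :
    ∫ y, ∑ j, y j * ⟪b y, fderiv ℝ b y (EuclideanSpace.single j 1)⟫ = -(3 / 2) * ∫ y, ‖b y‖ ^ 2 :=
        by
  have hbd : Differentiable ℝ b := hb1.differentiable one_ne_zero
  have hbc : Continuous b := hb1.continuous
  have hyjc : ∀ j, Continuous fun y : EuclideanSpace ℝ (Fin 3) => y j := fun j =>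
    (EuclideanSpace.proj (𝕜 := ℝ) j).continuous
  have hjj : ∀ j : Fin 3, (EuclideanSpace.single j (1 : ℝ) : EuclideanSpace ℝ (Fin 3)) j = 1 :=
    fun j => by simp
  have h2 : ∀ j, Integrable fun y => fderiv ℝ (fun z : EuclideanSpace ℝ (Fin 3) => z j) y
      (EuclideanSpace.single j 1) * ⟪b y, b y⟫ := by
    intro j
    simp_rw [backus_fderiv_coord, hjj, one_mul, real_inner_self_eq_norm_sq]
    exact hP
  have h3 : ∀ j, Integrable fun y => y j * ⟪fderiv ℝ b y (EuclideanSpace.single j 1), b y⟫ := fun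
      j =>
    (h1 j).congr (ae_of_all _ fun y => by dsimp only; rw [real_inner_comm])
  have h4 : ∀ j, Integrable fun y => y j * ⟪b y, b y⟫ := by
    intro j
    refine backus_integrable_of_bound ((hyjc j).mul (hbc.inner hbc)) hD5 fun y => ?_
    rw [norm_mul, real_inner_self_eq_norm_sq, Real.norm_of_nonneg (sq_nonneg ‖b y‖), sq, ←
        mul_assoc]
    refine mul_le_mul_of_nonneg_right ?_ (norm_nonneg _)
    exact mul_le_mul_of_nonneg_right (PiLp.norm_apply_le _ _) (norm_nonneg _)
  have hibp : ∀ j, ∫ y, y j * ⟪b y, fderiv ℝ b y (EuclideanSpace.single j 1)⟫ =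
      -(∫ y, ‖b y‖ ^ 2) - ∫ y, y j * ⟪fderiv ℝ b y (EuclideanSpace.single j 1), b y⟫ := by
    intro j
    have h := backus_ibp_smul_inner (EuclideanSpace.single j 1) (backus_differentiable_coord j)
        hbd hbd
      (h1 j) (h2 j) (h3 j) (h4 j)
    simpa only [backus_fderiv_coord, hjj, one_mul, real_inner_self_eq_norm_sq] using h
  have hcomm : ∀ j, ∫ y, y j * ⟪fderiv ℝ b y (EuclideanSpace.single j 1), b y⟫ =
      ∫ y, y j * ⟪b y, fderiv ℝ b y (EuclideanSpace.single j 1)⟫ := by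
    intro j
    refine integral_congr_ae (ae_of_all _ fun y => ?_)
    dsimp only
    rw [real_inner_comm]
  have hX : ∀ j, 2 * ∫ y, y j * ⟪b y, fderiv ℝ b y (EuclideanSpace.single j 1)⟫ = -∫ y, ‖b y‖ ^ 2
      := by
    intro j
    have h := hibp j
    rw [hcomm j] at h
    linarith
  have hsum : 2 * ∫ y, ∑ j, y j * ⟪b y, fderiv ℝ b y (EuclideanSpace.single j 1)⟫ = -3 * ∫ y, ‖b
      y‖ ^ 2 := by
    rw [integral_finsetSum _ fun j _ => h1 j, Finset.mul_sum,
      Finset.sum_congr rfl fun j _ => hX j]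
    simp only [Finset.sum_const, Finset.card_univ, Fintype.card_fin]
    ring
  linarith

/-- Dissipation: `∫ ⟪b, Δb⟫ = −∫ ∑ⱼ ‖∂ⱼ b‖²`, by the whole-space divergence lemma applied to
`Gⱼ = ⟪b, ∂ⱼ b⟫` (only the sum `⟪b, Δb⟫ + ∑ⱼ ‖∂ⱼ b‖² = ∑ⱼ ∂ⱼ Gⱼ` needs to be integrable). -/
theorem backus_integral_laplacian {b : EuclideanSpace ℝ (Fin 3) → EuclideanSpace ℝ (Fin 3)} (hb :
    ContDiff ℝ 2 b)
    (hD3 : Integrable fun y => ‖b y‖ * ‖fderiv ℝ b y‖)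
    (hS : Integrable fun y => ∑ j, ‖fderiv ℝ b y (EuclideanSpace.single j 1)‖ ^ 2)
    (hL : Integrable fun y => ⟪b y, Laplacian.laplacian b y⟫) :
    ∫ y, ⟪b y, Laplacian.laplacian b y⟫ = -∫ y, ∑ j, ‖fderiv ℝ b y (EuclideanSpace.single j 1)‖ ^
        2 := by
  have hb1 : ContDiff ℝ 1 b := hb.of_le one_le_two
  have hG : ∀ j, ContDiff ℝ 1 fun y => ⟪b y, fderiv ℝ b y (EuclideanSpace.single j 1)⟫ := fun j =>
    hb1.inner ℝ ((hb.fderiv_right (m := 1) (by norm_num)).clm_apply contDiff_const)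
  have hGi : ∀ j, Integrable fun y => ⟪b y, fderiv ℝ b y (EuclideanSpace.single j 1)⟫ := by
    intro j
    refine backus_integrable_of_bound
      (hb1.continuous.inner ((hb1.continuous_fderiv one_ne_zero).clm_apply continuous_const))
      hD3 fun y => ?_
    exact (norm_inner_le_norm _ _).trans
      (mul_le_mul_of_nonneg_left (backus_norm_apply_single_le _ _) (norm_nonneg _))
  have hsum : ∀ y, ∑ j, fderiv ℝ (fun y => ⟪b y, fderiv ℝ b y (EuclideanSpace.single j 1)⟫) y
      (EuclideanSpace.single j 1) =
      ⟪b y, Laplacian.laplacian b y⟫ + ∑ j, ‖fderiv ℝ b y (EuclideanSpace.single j 1)‖ ^ 2 := by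
    intro y
    rw [backus_inner_laplacian hb y]
    ring
  have hdiv : Integrable fun y => ∑ j, fderiv ℝ (fun y => ⟪b y, fderiv ℝ b y
      (EuclideanSpace.single j 1)⟫) y (EuclideanSpace.single j 1) := by
    simp_rw [hsum]
    exact hL.add hS
  have h0 : ∫ y, ∑ j, fderiv ℝ (fun y => ⟪b y, fderiv ℝ b y (EuclideanSpace.single j 1)⟫) y
      (EuclideanSpace.single j 1) = 0 :=
    backus_integral_sum_partial_eq_zero (fun j y => ⟪b y, fderiv ℝ b y (EuclideanSpace.single j
        1)⟫) hG hGi hdiv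
  simp_rw [hsum] at h0
  rw [integral_add hL hS] at h0
  linarith

end Summit.NavierStokesRegularity.NavierStokesRegularity.Theorems
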